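import Literature.MathematicalPhysics.QuantumFieldTheory.Balaban1983to89.B9SupplySockB9P3ZdAt

/-!
# `Balaban1983to89.B9SupplySockB9P3ZdAtBoundaryMode` — [Balaban1985BackgroundPropagators] (3.27) p. 395 / [Balaban1985RegularSpaces] p. 77, p. 86:
# THE BOUNDARY PURE-GAUGE MODE `d𝟙_{Ω₀}` — a kernel certificate that the member-local letter binders of `B9SupplySockB9P3ZdAt`
# {`Prop6At`, `InvAt`, `CurvAt`, `LandauAt`, `AvgAt`} are JOINTLY UNSATISFIABLE at truncation `m = 0` of every member whose `Ω₀` has a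
# boundary bond and whose level-0 restriction set covers `Ω₀`, and (§4) at EVERY truncation level `m ≤ k` under an ℓ∞-2 margin — every member of
# the cube sub-family `{□_j}` of (1.131), `Ω₀ = □₀`

statement-level skeleton of published theorems with citation tags; proofs where landed; nothing here is a claim about the
Yang–Mills mass gap

PDF held: `paper:balaban1985-cmp99-background-propagators` ([4] = B9; journal page = PDF page + 388): p. 395 (3.26)–(3.27), p. 394
(3.20)–(3.25), p. 393 (3.16), p. 404 (3.69); `paper:balaban1985-cmp99-regular-spaces-gauge-fixing` (B8; journal page = PDF page + 74): p. 77
(bond convention, (1.3)–(1.9)), p. 81 (1.29), p. 86 (1.55)–(1.59), p. 88 (1.68), p. 99 (1.131)–(1.132).  Read by this seat on the held text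
layers (2026-08-26∕27).

CITATION HEADER (lean-in-tree rule).  Cell `pub-ymgap` (HUMAN RULING D-0062, Track A), DAG node N06 [B9] → N05 [B8] junction lineage, seat
`pub-ymgap-dag-n06-b` (g10), 2026-08-27.  A NEW file; nothing landed is modified; count-neutral; a LOCATED finding about HYPOTHESIS SETS of
landed junction theorems (the theorems stay true).  Answers referee ref-A's open WATCH-JSAT (READ-4 ∕ READ-21 on p525454 ∕ p529172: «joint
satisfiability of the repaired letters — open, to be tested at a letters-at-instance file») for the FINITE-`Ω₀` road.

WHAT IS PRINTED (verbatim, text layer).  [4] p. 395: *«Δ_a = Δ + DRD* + Q*aQ … G(U) = G = (Δ_a↾Ω₀)⁻¹»* (3.26)–(3.27); p. 392: *«Δ = D*D + Δ′ …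
generalizing the operator ∂*∂ in the Abelian case»* (3.10).  B8 p. 77: *«we denote by Ω also the set of bonds ⋃_{x∈Ω} st(x) = {bonds b ⊂ T_η: at
least one end-point of b belongs to Ω}»*; p. 88: *«taking Λ_{k−1} ∪ B(Λ_k) as Λ_{k−1}»* (1.68) (the truncations); p. 99: *«Λ′₀ = T ∖ □₁»* (1.131)
— print's cube family has `Ω₀ = T` (no boundary); the tree's cube road (`B8Eq131CubesAdmissible.cubeFam false`, dag-n05-c `B8CubeMemberZd`) has
`Ω₀ = □₀`, a finite cube of `ℤᵈ`.

THE MECHANISM (this file, kernel-checked; `U₀ = 1`, any C⋆-algebra `𝔸`, any frame, any letters `ops`, any block parameter `M`).  Let `i` be a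
member with (h1) `i.Ω 0 ⊆ i.Λs 0 0` (at truncation `0` every site of `Ω₀` is a restriction site — (1.68) iterated down to `m = 0`: `Λs 0 0 =
Ω₀^{(0)}`; for the cube member `cubeLamS … 0 0 = □₀^{(0)} = □₀`, `B8CubeMemberZd.cubeLamS_self`) and (h2) a BOUNDARY BOND `⟨x₀, x₀ + e_μ₀⟩`,
`x₀ ∈ Ω₀`, `x₀ + e_μ₀ ∉ Ω₀` (every finite non-empty `Ω₀`; the upper corner of `□₀`).  Put `λ := 𝟙_{Ω₀}·1_𝔸` and `g := dλ`, `g(x, μ) = λ(x + e_μ) −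
λ(x)` — supported on the boundary bonds, hence in the class `E(Ω₀)` = `OnDom` (bonds with AN end-point in `Ω₀`, p. 77).  Then at `U₀ = 1`:
(i) `Jcur η 1 g = 0` (the flat plaquette derivative of a pure gauge vanishes, (3.4)); (ii) `Prop6At` puts `U₀ = 1 ∈ 𝔄_0({Ω_j}, α)` (every `α > 0`,
`B8Prop6OfThm4.one_inAk`) in the (3.35) class at `K₆α`, so `CurvAt` bounds `η³‖(Δ′(1)A)(b)‖` by `c₆₉·M·K₆α·|A|₍₋₁₎` for EVERY small `α > 0`:
`Δ′(1)A = 0` on the bonds of `Ω₀` for every `A ∈ E(Ω₀)`; (iii) by (h1) the Landau condition of record (`B8Eq138LandauZd.IsLandau138`, multiplier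
form) is VACUOUS at truncation `0` (the level-0 multiplier is free on all of `Ω₀`), so `LandauAt` forces `D R(1) D* A = 0` for every `A ∈ E(Ω₀)`;
(iv) the law `ZdIdx.hbox` keeps the locality box `{c₋, c₊}` of every level-0 constraint bond inside `Ω₀`, so `Q₀g = g = 0` on every constraint
bond, `|B₁(g)| = 0`, and `AvgBound` forces `(Q*aQ)(1)g = 0` on the bonds of `Ω₀`; likewise for `A = 0`.  Hence `Δ_a(1)g = 0 = Δ_a(1)0` on the
bonds of `Ω₀`, and `InvAt` ((3.27) «`G(U₀)J = A` for every `J` agreeing with `Δ_a(U₀)A` on the Ω₀-bonds») returns BOTH `G(1)0 = g` and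
`G(1)0 = 0`: `g = 0`, contradicting `g(x₀, μ₀) = −1`.

WHAT THIS MODULE PROVES (kernel, 0 sorry, standard axioms).
* §1 lattice facts: `plaqCovDeriv_one_grad` ∕ `Jcur_one_grad` ((3.4) at `U₀ = 1` on `dλ`), `isLandau138_zero_of_subset` (Landau vacuity at
  truncation `0`), `wsupB1_zero_eq_zero` (`|B₁| = 0` for a field vanishing on the bonds with both end-points in `Ω₀`, via `hbox`), two real-arithmetic
  helpers (`exists_small_window`, `nonpos_of_le_mul_small`).
* §2 ★★ `at_binders_false_zero`: (h1) + (h2) + `0 < c₆, K₆, a₃` + the five binders at `(M, i, 0)` ⊢ `False`.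
* §3 ★ `family_binders_false_of_member` (the binder FAMILIES of `B9SupplySockB9P3ZdAtFamilies.sockB9P3D4_allLevels_of_thm33_on` ∕ `…AtJoint` over
  any index map `ι` hitting one such member ⊢ `False`); `cube_zero_subset_lamS`, `cube_corner_boundary_bond` ((h1), (h2) for `Ω = cubeFam false …`,
  `Λs = cubeLamS …`, `ρ ≥ 1`); ★ `cube_binders_false_zero`; ★★ `cube_knit_binders_false`: the binder hypotheses `hP6 hinv hcurv hlan havg` of
  dag-n05-e's `B8Prop6CubeMemberOfThm33.prop6Printed_zdCub_of_thm33` (p530292 ∕ v1.1 p534210), VERBATIM over its cube subtype, ⊢ `False` (`d, L ≥ 1`,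
  `0 < c₆, K₆, a₃`; the subtype is inhabited by `B8CubeMemberZd.exists_member_cube`).
* §4 every truncation level: `QprimeT_zero_fun`, `linCovIter_zero_fun`, `covLap_eq_zero_of_vanish_near`, `covDivB_one_grad_eq_zero`,
  `isLandau138_zero_field`, ★ `isLandau138_one_grad_indicator` (the mode is in the Landau gauge of record under the ℓ∞-2 margin), ★
  `wsupB1_eq_zero_of_vanish_inside` (`|B₁| = 0` at all levels, `hbox` + `linCovIter_congr`), `weight_negOne_mono`; ★★ `at_binders_false` (margin
  hypothesis + boundary bond + the five binders at `(M, i, m)`, `m ≤ k` ⊢ `False`); `cube_deep`; ★★ `cube_binders_false` (every cube member, `ρ ≥ 2`,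
  every `m ≤ k`).

CONSEQUENCES (count-neutral; LOCATED, class MISSTATED-HYPOTHESIS-SET).  (a) The cube-road junction knits (`prop6Printed_zdCub_of_thm33`, `…'`) and
this lineage's finite-`Ω₀` family forms (`sockB9P3D4_allLevels_of_thm33[_on]`, `sh59D_cubeSubfamily_of_thm33[_on]`, `sockCube_joint_of_thm33_on`,
`sockB9P3D4_allLevels_explicit_on`, `sh59D_cube_explicit_on` at index maps into the cube sub-family; g4's `sockB9P3_allLevels_of_thm33` over ALL
members a fortiori) have UNSATISFIABLE hypothesis sets: true, vacuous.  (b) NOT affected: the `Ω₀ = ℤᵈ` road (dag-n05-d's record knit through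
`sockB9P3_allLevels_of_thm33_univ_on`, `sockUniv_joint_of_thm33_on`; print's `Ω₀ = T`): no boundary bond, `d𝟙_{ℤᵈ} = 0`.  (c) WHERE THE TYPING
DEPARTS FROM PRINT (for the owners' repair, not decided here): print's cube family is `(T, □₁, …, □_k)` (`Λ′₀ = T ∖ □₁`), i.e. `top = true`; at a
finite `Ω₀` the typed level-0 constraint-bond law (`hbox`: B7's averaging box `{c₋, c₊} ⊂ Ω₀`) excludes the boundary bonds that the p. 77
convention assigns to `Λ₀`, so neither `Q*aQ` nor the (vacuous) Landau letter sees the gauge mode `d𝟙_{Ω₀}` that the restricted gauge group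
`{u = 1 off Ω₀}` still contains; candidate repairs: (r1) run the cube road at `top = true` (the univ road); (r2) admit the boundary bonds of `Ω₀` as
level-0 constraint bonds (law `hbox` at `j = 0` in the p. 77 convention); (r3) restrict `E(Ω₀)` in `InvAt` to modes fixed by (1.29).  Levels
`m ≥ 1` die by the SAME mode (§4): the boundary layer of `□₀` lies in `Λ₀ = □₀ ∖ □₁` (margin `R₁M₁ ≥ 2`), so `g` is in the Landau gauge of record
at every truncation and `|B₁(g)| = 0` at every level — restricting the truncation levels is NOT a repair.
HONEST SCOPE: a refutation of joint satisfiability of TYPED hypothesis sets by an explicit field; nothing of [B9]∕[B8] is asserted or denied; N05∕N06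
NOT discharged; nothing continuum ∕ ℝ⁴ ∕ OS ∕ mass-gap ∕ Clay.
-/

noncomputable section

open NormedSpace

namespace Literature.MathematicalPhysics.QuantumFieldTheory.Balaban1983to89.B9SupplySockB9P3ZdAtBoundaryMode

open B7Prop1Explicit (e)
open B7Prop1Local (InBox loK bondHiK)
open B7Prop2Explicit (unitaryUnits)
open B7Prop4GeneralLevels (linCovIter)
open B7Eq78Linearization (conjR)
open B8Ineq132 (covDerivFwd covDeriv InAk BondTouches)
open B8Eq140Level (SideTouches)
open B8Eq146AExpansion (iEta plaqCovDeriv)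
open B8Eq143PlaqExpansion (pdiv)
open B8Eq155JBound (Jcur wsup)
open B8ScaledSupNorm (bondNorm msup weight Bdd)
open B8Eq138LandauZd (IsLandau138 QT QprimeT covDivB covLap)
open B8LeafModelZd (ZdIdx)
open B9SupplySockB9P3ZdLetters (OpsZd deltaAOf)
open B9SupplySockB9P3ZdLettersOmega (OnDom)
open B9SupplySockB9P3ZdAt (Prop6At InvAt CurvAt LandauAt AvgAt)

-- `Site` alone could resolve to the torus sites of `Setup.lean`; re-export the `ℤ^d` sites of `B7Prop1Explicit`.
export B7Prop1Explicit (Site)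

variable {d : ℕ} {𝔸 : Type*} [CStarAlgebra 𝔸]

/-! ## §1 Lattice facts: a flat pure gauge has no plaquette derivative, the Landau condition is vacuous at truncation `0`,
the averaging data `B₁` does not see a field vanishing on the bonds inside `Ω₀` -/

/-- **(3.4) at the flat background on a pure gauge**: `(D^η_1 dλ)(p) = 0` for every `λ : T_η → 𝔸` — the four transported edge
variables of `dλ` around `∂p` telescope («generalizing the operator ∂*∂ in the Abelian case», p. 392). [cite: Balaban1985BackgroundPropagators, (3.4) p.391, p.392 (after (3.10))] -/
theorem plaqCovDeriv_one_grad (η : ℝ) (lam : Site d → 𝔸) (μ ν : Fin d) (x : Site d) :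
    plaqCovDeriv η (1 : Site d → Fin d → 𝔸ˣ) (fun y κ => lam (y + e κ) - lam y) μ ν x = 0 := by
  rw [B8Eq146AExpansion.plaqCovDeriv_eq_covDerivFwd]
  simp only [covDerivFwd, Pi.one_apply, B8Ineq132.one_conjR]
  rw [← smul_sub, add_right_comm x (e ν) (e μ)]
  have : lam (x + e μ + e ν) - lam (x + e μ) - (lam (x + e ν) - lam x) -
      (lam (x + e μ + e ν) - lam (x + e ν) - (lam (x + e μ) - lam x)) = 0 := by abel
  rw [this, smul_zero]

/-- **`J = D^{η*}_1 D^η_1 (dλ) = 0`**: B8's current (1.55) of a pure gauge at the flat background vanishes identically. [cite: Balaban1985RegularSpaces, (1.55) p.86, (1.2) p.76; Balaban1985BackgroundPropagators, (3.4) p.391] -/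
theorem Jcur_one_grad (η : ℝ) (lam : Site d → 𝔸) (μ : Fin d) (x : Site d) :
    Jcur η (1 : Site d → Fin d → 𝔸ˣ) (fun y κ => lam (y + e κ) - lam y) μ x = 0 := by
  have hF : plaqCovDeriv η (1 : Site d → Fin d → 𝔸ˣ) (fun y κ => lam (y + e κ) - lam y) = fun _ _ _ => 0 := by
    funext μ ν x; exact plaqCovDeriv_one_grad η lam μ ν x
  rw [B8Eq155JBound.Jcur_def, hF]
  simp [pdiv, covDeriv, conjR]

/-- **THE LANDAU CONDITION OF RECORD IS VACUOUS AT TRUNCATION `0` WHEN `Ω₀ ⊆ Λ₀`**: the multiplier form (1.38)∕(1.42)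
`Δ^η_{U₀}↾Ω₀(D^{η*}_{U₀}A) = Q′(U₀)ᵀμ on Ω₀` (`B8Eq138LandauZd.IsLandau138 L 0 …`) holds for EVERY bond field `A` and every background: at `m = 0`
the right-hand side is `𝟙_{Λ₀}·μ₀`, and `μ₀` may be taken equal to the left-hand side on `Ω₀ ⊆ Λ₀`. [cite: Balaban1985RegularSpaces, (1.38) p.82, (1.42) p.83, (1.68) p.88; Balaban1985BackgroundPropagators, (3.24)–(3.25) p.394] -/
theorem isLandau138_zero_of_subset {L : ℕ} {η : ℝ} {Ω₀ : Set (Site d)} {Λs : ℕ → Set (Site d)} (h : Ω₀ ⊆ Λs 0)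
    (U₀ : Site d → Fin d → 𝔸ˣ) (A : Site d → Fin d → 𝔸) : IsLandau138 L 0 η Ω₀ Λs U₀ A := by
  refine ⟨fun _ x => covLap η U₀ (Ω₀.indicator (covDivB η U₀ A)) x, fun x hx => ?_⟩
  simp only [QT, zero_add, Finset.sum_range_one, QprimeT, Set.indicator_of_mem (h hx)]

/-- **`|B₁| = 0` AT TRUNCATION `0` FOR A FIELD VANISHING ON THE BONDS WITH BOTH END-POINTS IN `Ω₀`**: the level-0 averaging is the identity
(`linCovIter … 0 = id`, (127) of [3]) and the member law `ZdIdx.hbox` puts both end-points of every level-0 constraint bond in `Ω₀` (the locality box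
`{c₋, c₊}` of `B7Prop1Local.loK ∕ bondHiK`), so the consumer's functional `wsup 1 (Q_j B over the constraint bonds)` of B8 (1.56) vanishes. [cite: Balaban1985RegularSpaces, (1.56) p.86, (1.31) p.82; Balaban1985Averaging, (127) p.37, p.24 (after (43))] -/
theorem wsupB1_zero_eq_zero {L : ℕ} (hL : 1 ≤ L) (i : ZdIdx d L) (U₀ : Site d → Fin d → 𝔸ˣ) {B : Site d → Fin d → 𝔸}
    (hB : ∀ (z : Site d) (κ : Fin d), z ∈ i.Ω 0 → z + e κ ∈ i.Ω 0 → B z κ = 0) :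
    wsup 1 (fun p : {p : ℕ × (Site d × Fin d) // p.1 ≤ 0 ∧ p.2 ∈ i.Λb 0 p.1} =>
      linCovIter L U₀ B p.1.1 p.1.2.1 p.1.2.2) = 0 := by
  apply le_antisymm
  · refine B8Eq155JBound.wsup_le (fun p => ?_) le_rfl
    obtain ⟨⟨j, z, κ⟩, hj, hc⟩ := p
    obtain rfl : j = 0 := Nat.le_zero.mp hj
    have h1 : z ∈ i.Ω 0 := i.hbox 0 (Nat.zero_le _) 0 le_rfl (z, κ) hc z
      (by simpa using B8CubeMemberZd.smul_mem_bondBox hL 0 z κ)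
    have h2 : z + e κ ∈ i.Ω 0 := i.hbox 0 (Nat.zero_le _) 0 le_rfl (z, κ) hc (z + e κ)
      (by simpa using B8CubeMemberZd.smul_add_mem_bondBox hL 0 z κ)
    simp [hB z κ h1 h2]
  · exact Real.iSup_nonneg (fun p => mul_nonneg zero_le_one (norm_nonneg _))

/-- Real arithmetic: for `c₆, K₆, a₃ > 0` and any `M` there is `ε > 0` with `Mα ≤ c₆` and `M·K₆α ≤ a₃` for all `0 < α ≤ ε` (the common window of
Proposition 6's `Mα₀ ≤ c₆` and Theorem 3.11's `Mα₀ ≤ a₃` at `α₀ = K₆α`). [cite: Balaban1985RegularSpaces, Prop. 6 p.99; Balaban1985BackgroundPropagators, Thm 3.11 p.416] -/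
theorem exists_small_window {c₆ K₆ a₃ : ℝ} (hc₆ : 0 < c₆) (hK₆ : 0 < K₆) (ha₃ : 0 < a₃) (M : ℝ) :
    ∃ ε : ℝ, 0 < ε ∧ ∀ α : ℝ, 0 < α → α ≤ ε → M * α ≤ c₆ ∧ M * (K₆ * α) ≤ a₃ := by
  refine ⟨min (c₆ / (|M| + 1)) (a₃ / ((|M| + 1) * K₆)), lt_min (by positivity) (by positivity), fun α hα hαε => ?_⟩
  have hM1 : 0 < |M| + 1 := by positivity
  have hq : |M| / (|M| + 1) ≤ 1 := by rw [div_le_one hM1]; linarith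
  have h1 : M * α ≤ |M| * α := mul_le_mul_of_nonneg_right (le_abs_self M) hα.le
  constructor
  · have h2 : |M| * α ≤ |M| * (c₆ / (|M| + 1)) := mul_le_mul_of_nonneg_left (hαε.trans (min_le_left _ _)) (abs_nonneg M)
    have h3 : |M| * (c₆ / (|M| + 1)) = c₆ * (|M| / (|M| + 1)) := by ring
    nlinarith
  · have h2 : |M| * α ≤ |M| * (a₃ / ((|M| + 1) * K₆)) :=
      mul_le_mul_of_nonneg_left (hαε.trans (min_le_right _ _)) (abs_nonneg M)
    have h3 : K₆ * (|M| * (a₃ / ((|M| + 1) * K₆))) = a₃ * (|M| / (|M| + 1)) := by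
      field_simp
    have h4 : M * (K₆ * α) = K₆ * (M * α) := by ring
    nlinarith

/-- Real arithmetic: a quantity bounded by `C·α` for every `0 < α ≤ ε` is `≤ 0` (how the `O(α₀)` bound (3.69) forces `Δ′(1) = 0`). [cite: Balaban1985BackgroundPropagators, (3.69) p.404] -/
theorem nonpos_of_le_mul_small {T C ε : ℝ} (hε : 0 < ε) (h : ∀ α : ℝ, 0 < α → α ≤ ε → T ≤ C * α) : T ≤ 0 := by
  by_contra hT
  have hT : 0 < T := lt_of_not_ge hT
  have hC1 : 0 < |C| + 1 := by positivity
  set α : ℝ := min ε (T / (2 * (|C| + 1))) with hα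
  have hαpos : 0 < α := lt_min hε (by positivity)
  have h1 := h α hαpos (min_le_left _ _)
  have h2 : C * α ≤ |C| * α := mul_le_mul_of_nonneg_right (le_abs_self C) hαpos.le
  have h3 : |C| * α ≤ |C| * (T / (2 * (|C| + 1))) := mul_le_mul_of_nonneg_left (min_le_right _ _) (abs_nonneg C)
  have h4 : |C| * (T / (2 * (|C| + 1))) = (T / 2) * (|C| / (|C| + 1)) := by
    field_simp
  have h5 : |C| / (|C| + 1) ≤ 1 := by rw [div_le_one hC1]; linarith
  nlinarith


/-! ## §2 The refutation at truncation `m = 0` -/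

section Refutation

variable [Nontrivial 𝔸]
variable {I : Type} (bg : I → B9.Backgrounds) {L : ℕ} (mem : ℝ → ZdIdx d L → ℕ → I)
variable (ιCfg : ∀ (M : ℝ) (i : ZdIdx d L) (m : ℕ) (U₀ : Site d → Fin d → 𝔸ˣ),
  (∀ x κ, U₀ x κ ∈ unitaryUnits 𝔸) → (bg (mem M i m)).Cfg)
variable (ops : ℝ → ZdIdx d L → ℕ → OpsZd d 𝔸)

/-- ★★ **THE BOUNDARY PURE-GAUGE MODE REFUTES THE JOINT SATISFIABILITY OF THE MEMBER-LOCAL LETTER BINDERS AT TRUNCATION `0`.**  At a member `i`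
of the `ℤᵈ` family with `i.Ω 0 ⊆ i.Λs 0 0` (every site of `Ω₀` a level-0 restriction site, (1.68) at `m = 0`) and a boundary bond `⟨x₀, x₀ + e_μ₀⟩`
(`x₀ ∈ Ω₀ ∌ x₀ + e_μ₀`), for ANY frame `bg ∕ mem ∕ ιCfg`, ANY operator letters `ops`, any block parameter `M` and constants with `0 < c₆, K₆, a₃`, the
five binders `Prop6At`, `InvAt`, `CurvAt`, `LandauAt`, `AvgAt` at `(M, i, 0)` cannot hold together: with `g = d(𝟙_{Ω₀}·1)` ∈ E(Ω₀) and `U₀ = 1`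
they give `Δ_a(1)g = 0 = Δ_a(1)0` on the bonds of `Ω₀` ((3.26): `J(g) = 0` by (3.4), `Δ′(1)g = 0` by (3.69) as `α₀ → 0`, `DR(1)D*g = 0` by the vacuous
Landau condition, `Q*aQ g = 0` by `|B₁(g)| = 0`), whence (3.27) returns `G(1)0 = g` and `G(1)0 = 0`, but `g(x₀, μ₀) = −1 ≠ 0`.
[cite: Balaban1985BackgroundPropagators, (3.26)–(3.27) p.395, (3.4) p.391, (3.69) p.404, (3.16) p.393, (3.20)–(3.25) p.394; Balaban1985RegularSpaces, p.77 (bond convention), (1.58) p.86, (1.68) p.88] -/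
theorem at_binders_false_zero (hL : 1 ≤ L) {c35 c₆ K₆ a₃ c69 q M : ℝ} (hc₆ : 0 < c₆) (hK₆ : 0 < K₆) (ha₃ : 0 < a₃)
    (i : ZdIdx d L) (hΛ : i.Ω 0 ⊆ i.Λs 0 0) {x₀ : Site d} {μ₀ : Fin d} (hx₀ : x₀ ∈ i.Ω 0) (hx₁ : x₀ + e μ₀ ∉ i.Ω 0)
    (hP6 : Prop6At bg L mem ιCfg c35 c₆ K₆ M i 0) (hinv : InvAt bg L mem ιCfg ops c35 a₃ M i 0)
    (hcurv : CurvAt bg L mem ιCfg ops c35 a₃ c69 M i 0) (hlan : LandauAt bg L mem ιCfg ops c35 a₃ M i 0)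
    (havg : AvgAt L ops q M i 0) : False := by
  classical
  have hη : 0 < i.η := i.hη
  -- the flat background `U₀ = 1` is unitary and lies in `𝔄_0({Ω_j}, α)` for every `α > 0`
  have h1u : ∀ x κ, (1 : Site d → Fin d → 𝔸ˣ) x κ ∈ unitaryUnits 𝔸 := fun _ _ => (unitaryUnits 𝔸).one_mem
  obtain ⟨ε, hε, hεP⟩ := exists_small_window hc₆ hK₆ ha₃ M
  have hReg : ∀ α : ℝ, 0 < α → α ≤ ε → (bg (mem M i 0)).Reg335 c35 (K₆ * α) (ιCfg M i 0 1 h1u) :=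
    fun α hα hαε => hP6 α 1 h1u hα (hεP α hα hαε).1 (B8Prop6OfThm4.one_inAk hL 0 hη hα i.Ω)
  -- the boundary pure-gauge mode `g = d𝟙_{Ω₀}` and the zero field, both in E(Ω₀)
  set lam : Site d → 𝔸 := (i.Ω 0).indicator (fun _ => (1 : 𝔸)) with hlam
  set g : Site d → Fin d → 𝔸 := fun x μ => lam (x + e μ) - lam x with hg
  have hg_in : ∀ (y : Site d) (τ : Fin d), y ∈ i.Ω 0 → y + e τ ∈ i.Ω 0 → g y τ = 0 := by
    intro y τ h1 h2
    simp [hg, hlam, Set.indicator_of_mem h1, Set.indicator_of_mem h2]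
  have hgOn : OnDom L 0 i.η i.Ω g := by
    refine ⟨fun y τ h => ?_, weight L i.η (-(1 : ℝ)) 0 * (‖(1 : 𝔸)‖ + ‖(1 : 𝔸)‖), fun j hj b _ => ?_⟩
    · simp only [BondTouches, not_or] at h
      simp [hg, hlam, Set.indicator_of_notMem h.1, Set.indicator_of_notMem h.2]
    · obtain rfl : j = 0 := Nat.le_zero.mp hj
      refine mul_le_mul_of_nonneg_left ?_ (B8ScaledSupNorm.weight_nonneg L hη.le _ _)
      calc ‖g b.1 b.2‖ ≤ ‖lam (b.1 + e b.2)‖ + ‖lam b.1‖ := norm_sub_le _ _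
        _ ≤ ‖(1 : 𝔸)‖ + ‖(1 : 𝔸)‖ :=
          add_le_add (norm_indicator_le_norm_self _ _) (norm_indicator_le_norm_self _ _)
  have h0On : OnDom L 0 i.η i.Ω (0 : Site d → Fin d → 𝔸) :=
    ⟨fun _ _ _ => rfl, 0, fun j _ b _ => by simp⟩
  -- (a) the averaging letter vanishes at the bonds of `Ω₀` on every field of E(Ω₀) that vanishes on the bonds INSIDE `Ω₀`
  have hQQ : ∀ A : Site d → Fin d → 𝔸, OnDom L 0 i.η i.Ω A →
      (∀ (z : Site d) (κ : Fin d), z ∈ i.Ω 0 → z + e κ ∈ i.Ω 0 → A z κ = 0) →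
      ∀ (y : Site d) (τ : Fin d), BondTouches (i.Ω 0) y τ → (ops M i 0).QQ 1 A y τ = 0 := by
    intro A hA hAin y τ hb
    have h := havg 1 h1u A hA 0 le_rfl y τ hb
    have hw := wsupB1_zero_eq_zero hL i (1 : Site d → Fin d → 𝔸ˣ) (B := iEta i.η A)
      (fun z κ h1 h2 => by simp [iEta, hAin z κ h1 h2])
    rw [hw, mul_zero, pow_zero, one_mul] at h
    exact norm_le_zero_iff.mp (le_of_mul_le_mul_left (by rw [mul_zero]; exact h) (pow_pos hη 3))
  -- (b) the Landau letter vanishes identically on E(Ω₀): the Landau condition of truncation `0` is vacuous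
  have hDRDs : ∀ A : Site d → Fin d → 𝔸, OnDom L 0 i.η i.Ω A →
      ∀ (y : Site d) (τ : Fin d), (ops M i 0).DRDs 1 A y τ = 0 := fun A hA y τ =>
    hlan (K₆ * ε) 1 h1u (by positivity) (hεP ε hε le_rfl).2 (hReg ε hε le_rfl) A hA
      (isLandau138_zero_of_subset hΛ 1 A) y τ
  -- (c) the curvature letter vanishes at the bonds of `Ω₀` on E(Ω₀) at `U₀ = 1`: its bound is `O(α₀)|A|` for every small `α₀ > 0`
  have hDp : ∀ A : Site d → Fin d → 𝔸, OnDom L 0 i.η i.Ω A →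
      ∀ (y : Site d) (τ : Fin d), BondTouches (i.Ω 0) y τ → (ops M i 0).Dp 1 A y τ = 0 := by
    intro A hA y τ hb
    have hT : i.η ^ 3 * ‖(ops M i 0).Dp 1 A y τ‖ ≤ 0 := by
      refine nonpos_of_le_mul_small (C := c69 * M * K₆ *
        msup L 0 i.η (-(1 : ℝ)) (fun j (b : Site d × Fin d) => SideTouches (i.Ω j) b.1 b.2) (fun b => A b.1 b.2)) hε
        (fun α hα hαε => ?_)
      have h := hcurv (K₆ * α) 1 h1u (by positivity) (hεP α hα hαε).2 (hReg α hα hαε) A hA 0 le_rfl y τ hb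
      rw [pow_zero, one_mul] at h
      linarith
    exact norm_le_zero_iff.mp (le_of_mul_le_mul_left (by rw [mul_zero]; exact hT) (pow_pos hη 3))
  -- (d) so `Δ_a(1)g = 0 = Δ_a(1)0` on the bonds of `Ω₀`, and (3.27) returns both `g` and `0` from the datum `J = 0`
  have hR := hReg ε hε le_rfl
  have hJg : ∀ (y : Site d) (τ : Fin d), BondTouches (i.Ω 0) y τ →
      (0 : Site d → Fin d → 𝔸) y τ = deltaAOf i.η (ops M i 0) 1 g y τ := by
    intro y τ hb
    rw [deltaAOf, hDp g hgOn y τ hb, hDRDs g hgOn y τ, hQQ g hgOn hg_in y τ hb, hg, Jcur_one_grad]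
    simp
  have hJ0 : ∀ (y : Site d) (τ : Fin d), BondTouches (i.Ω 0) y τ →
      (0 : Site d → Fin d → 𝔸) y τ = deltaAOf i.η (ops M i 0) 1 0 y τ := by
    intro y τ hb
    rw [deltaAOf, hDp 0 h0On y τ hb, hDRDs 0 h0On y τ, hQQ 0 h0On (fun _ _ _ _ => rfl) y τ hb,
      B9SupplySockB9P3ZdLettersOmega.Jcur_zero]
    simp
  have hGg : (ops M i 0).Gop 1 0 = g :=
    hinv (K₆ * ε) 1 h1u (by positivity) (hεP ε hε le_rfl).2 hR g hgOn 0 hJg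
  have hG0 : (ops M i 0).Gop 1 0 = 0 :=
    hinv (K₆ * ε) 1 h1u (by positivity) (hεP ε hε le_rfl).2 hR 0 h0On 0 hJ0
  have hg0 : g x₀ μ₀ = 0 := by rw [← hGg, hG0]; rfl
  have hg1 : g x₀ μ₀ = -1 := by
    simp [hg, hlam, Set.indicator_of_mem hx₀, Set.indicator_of_notMem hx₁]
  rw [hg1] at hg0
  exact one_ne_zero (neg_eq_zero.mp hg0)

end Refutation


/-! ## §3 The family forms, and the cube sub-family of (1.131) (`Ω₀ = □₀` finite) -/

section Families

variable [Nontrivial 𝔸]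
variable {I : Type} (bg : I → B9.Backgrounds) {L : ℕ} (mem : ℝ → ZdIdx d L → ℕ → I)
variable (ιCfg : ∀ (M : ℝ) (i : ZdIdx d L) (m : ℕ) (U₀ : Site d → Fin d → 𝔸ˣ),
  (∀ x κ, U₀ x κ ∈ unitaryUnits 𝔸) → (bg (mem M i m)).Cfg)
variable (ops : ℝ → ZdIdx d L → ℕ → OpsZd d 𝔸)

/-- ★ **THE BINDER FAMILIES OF THE `_on` JUNCTION FORMS ARE UNSATISFIABLE OVER ANY INDEX MAP THAT HITS ONE SUCH MEMBER** — the hypotheses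
`hP6 hinv hcurv hlan havg` of `B9SupplySockB9P3ZdAtFamilies.sockB9P3D4_allLevels_of_thm33_on` (and of the `…AtJoint` explicit ∕ joint forms), verbatim
over `ι : J → ZdIdx d L`, yield `False` as soon as some `ι j₀` has `Ω₀ ⊆ Λs 0 0` and a boundary bond (instantiate at `(M₃, j₀, 0)`).
[cite: Balaban1985BackgroundPropagators, (3.27) p.395; Balaban1985RegularSpaces, (1.58)–(1.59) p.86, p.77 (bond convention)] -/
theorem family_binders_false_of_member (hL : 1 ≤ L) {J : Type*} (ι : J → ZdIdx d L) (j₀ : J)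
    (hΛ : (ι j₀).Ω 0 ⊆ (ι j₀).Λs 0 0) {x₀ : Site d} {μ₀ : Fin d} (hx₀ : x₀ ∈ (ι j₀).Ω 0) (hx₁ : x₀ + e μ₀ ∉ (ι j₀).Ω 0)
    {c35 c₆ K₆ M₃ a₃ c69 q : ℝ} (hc₆ : 0 < c₆) (hK₆ : 0 < K₆) (ha₃ : 0 < a₃)
    (hP6 : ∀ (M : ℝ) (j : J) (m : ℕ), M₃ ≤ M → Prop6At bg L mem ιCfg c35 c₆ K₆ M (ι j) m)
    (hinv : ∀ (M : ℝ) (j : J) (m : ℕ), M₃ ≤ M → InvAt bg L mem ιCfg ops c35 a₃ M (ι j) m)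
    (hcurv : ∀ (M : ℝ) (j : J) (m : ℕ), M₃ ≤ M → CurvAt bg L mem ιCfg ops c35 a₃ c69 M (ι j) m)
    (hlan : ∀ (M : ℝ) (j : J) (m : ℕ), M₃ ≤ M → LandauAt bg L mem ιCfg ops c35 a₃ M (ι j) m)
    (havg : ∀ (M : ℝ) (j : J) (m : ℕ), AvgAt L ops q M (ι j) m) : False :=
  at_binders_false_zero bg mem ιCfg ops hL hc₆ hK₆ ha₃ (ι j₀) hΛ hx₀ hx₁ (hP6 M₃ j₀ 0 le_rfl) (hinv M₃ j₀ 0 le_rfl)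
    (hcurv M₃ j₀ 0 le_rfl) (hlan M₃ j₀ 0 le_rfl) (havg M₃ j₀ 0)

open B8Eq131CubesAdmissible (cubeFam cubeFam_false_zero)
open B8Eq131Cubes (cube sqLo sqHi bLo bHi gs one_le_gs)
open B8CubeMemberZd (cubeLamS cubeLamB cubeLamS_self exists_member_cube)

/-- **(h1) for the cube member of (1.131)**: `Ω₀ = □₀` (`cubeFam false … 0`) IS the level-0 restriction set of truncation `0`
(`cubeLamS … 0 0 = □₀^{(0)}`, «taking Λ_{k−1} ∪ B(Λ_k) as Λ_{k−1}» iterated). [cite: Balaban1985RegularSpaces, (1.68) p.88, (1.131) p.99, p.98] -/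
theorem cube_zero_subset_lamS {i : ZdIdx d L} {a : Site d} {M ρ : ℕ}
    (hΩ : i.Ω = cubeFam false L a M ρ i.k) (hΛs : i.Λs = cubeLamS L a M ρ i.k) : i.Ω 0 ⊆ i.Λs 0 0 := by
  intro x hx
  rw [hΛs, cubeLamS_self]
  rw [hΩ, cubeFam_false_zero] at hx
  simpa [cube] using hx

/-- **(h2) for the cube member of (1.131)**: the upper corner `x₀` of `□₀` (`B8Eq131Cubes.sqHi … 0`; `□₀ ≠ ∅` as the margin `R₁M₁·Σ Lⁱ ≥ 1`) lies in
`Ω₀ = □₀` and `x₀ + e_μ` does not, for every direction `μ`. [cite: Balaban1985RegularSpaces, p.98 («□_j ⊃ □_{j+1} and a distance between boundaries of these cubes is equal to R₁M₁Lʲη»), (1.131) p.99] -/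
theorem cube_corner_boundary_bond {i : ZdIdx d L} {a : Site d} {M ρ : ℕ} (hρ : 1 ≤ ρ)
    (hΩ : i.Ω = cubeFam false L a M ρ i.k) (μ : Fin d) :
    sqHi L a M ρ i.k 0 ∈ i.Ω 0 ∧ sqHi L a M ρ i.k 0 + e μ ∉ i.Ω 0 := by
  have hr : (1 : ℤ) ≤ ((ρ * gs L (i.k - 0) : ℕ) : ℤ) := by
    have := Nat.mul_le_mul hρ (one_le_gs L (i.k - 0))
    rw [one_mul] at this
    exact_mod_cast this
  have hLM : (0 : ℤ) ≤ ((L : ℤ) ^ (i.k - 0)) * (M : ℤ) := by positivity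
  rw [hΩ, cubeFam_false_zero]
  refine ⟨fun n => ?_, fun h => ?_⟩
  · simp only [B8Ineq130.tlo_zero, B8Ineq130.thi_zero]
    refine ⟨?_, le_rfl⟩
    simp only [sqLo, sqHi, bLo, bHi]
    have e1 : ((L : ℤ) ^ (i.k - 0)) * (a n + (M : ℤ)) = ((L : ℤ) ^ (i.k - 0)) * a n + ((L : ℤ) ^ (i.k - 0)) * (M : ℤ) :=
      mul_add _ _ _
    linarith
  · have h2 := (h μ).2
    simp only [B8Ineq130.thi_zero, B7Prop1Local.add_e_apply, if_true] at h2
    linarith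

/-- ★ **AT EVERY CUBE MEMBER `{□_j}` OF (1.131) (`Ω = cubeFam false L a M ρ k`, `Λs = cubeLamS …`, `ρ ≥ 1`, `d ≥ 1`) THE FIVE BINDERS AT TRUNCATION `0`
ARE JOINTLY UNSATISFIABLE** (`at_binders_false_zero` with (h1) = `cube_zero_subset_lamS`, (h2) = `cube_corner_boundary_bond`).
[cite: Balaban1985RegularSpaces, (1.131) p.99, (1.68) p.88, p.77 (bond convention); Balaban1985BackgroundPropagators, (3.27) p.395] -/
theorem cube_binders_false_zero (hL : 1 ≤ L) {c35 c₆ K₆ a₃ c69 q M : ℝ} (hc₆ : 0 < c₆) (hK₆ : 0 < K₆) (ha₃ : 0 < a₃)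
    (μ : Fin d) (i : ZdIdx d L) {a : Site d} {Mc ρ : ℕ} (hρ : 1 ≤ ρ)
    (hΩ : i.Ω = cubeFam false L a Mc ρ i.k) (hΛs : i.Λs = cubeLamS L a Mc ρ i.k)
    (hP6 : Prop6At bg L mem ιCfg c35 c₆ K₆ M i 0) (hinv : InvAt bg L mem ιCfg ops c35 a₃ M i 0)
    (hcurv : CurvAt bg L mem ιCfg ops c35 a₃ c69 M i 0) (hlan : LandauAt bg L mem ιCfg ops c35 a₃ M i 0)
    (havg : AvgAt L ops q M i 0) : False :=
  at_binders_false_zero bg mem ιCfg ops hL hc₆ hK₆ ha₃ i (cube_zero_subset_lamS hΩ hΛs)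
    (cube_corner_boundary_bond hρ hΩ μ).1 (cube_corner_boundary_bond hρ hΩ μ).2 hP6 hinv hcurv hlan havg

/-- ★★ **THE LETTER-BINDER HYPOTHESES OF THE CUBE-ROAD JUNCTION KNIT ARE JOINTLY UNSATISFIABLE.**  The hypotheses `hP6 hinv hcurv hlan havg` of
dag-n05-e's `B8Prop6CubeMemberOfThm33.prop6Printed_zdCub_of_thm33` (and of its v1.1 primed form) — the member-local binders over the cube sub-family
`{i ∕∕ ∃ a M ρ, L ≤ ρ ≤ M, 11d < M, L ≤ dM, i.Ω = cubeFam false …, i.Λs = cubeLamS …, i.Λb = cubeLamB …}`, VERBATIM — together with `0 < c₆, K₆, a₃`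
(also hypotheses there) prove `False` for `d, L ≥ 1`: the sub-family is inhabited (`B8CubeMemberZd.exists_member_cube` at `a = 0`, `ρ = L`,
`M = 11d + L + 1`, `k = 1`, `η = 1`) and `cube_binders_false_zero` applies at `(M₃, that member, 0)`.  The knit is TRUE and VACUOUS; located repair
options in the module docstring. [cite: Balaban1985RegularSpaces, Prop. 6 p.99, (1.131) p.99, (1.58)–(1.59) p.86; Balaban1985BackgroundPropagators, Thm 3.3 p.399, (3.27) p.395] -/
theorem cube_knit_binders_false (hd : 1 ≤ d) (hL : 1 ≤ L) {c35 c₆ K₆ M₃ a₃ c69 q : ℝ}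
    (hc₆ : 0 < c₆) (hK₆ : 0 < K₆) (ha₃ : 0 < a₃)
    (hP6 : ∀ (M : ℝ) (j : {i : ZdIdx d L // ∃ (a : Site d) (M ρ : ℕ), L ≤ ρ ∧ ρ ≤ M ∧ 11 * d < M ∧ L ≤ d * M ∧
          i.Ω = cubeFam false L a M ρ i.k ∧ i.Λs = cubeLamS L a M ρ i.k ∧ i.Λb = cubeLamB L a M ρ i.k}) (m : ℕ),
      M₃ ≤ M → Prop6At bg L mem ιCfg c35 c₆ K₆ M j.1 m)
    (hinv : ∀ (M : ℝ) (j : {i : ZdIdx d L // ∃ (a : Site d) (M ρ : ℕ), L ≤ ρ ∧ ρ ≤ M ∧ 11 * d < M ∧ L ≤ d * M ∧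
          i.Ω = cubeFam false L a M ρ i.k ∧ i.Λs = cubeLamS L a M ρ i.k ∧ i.Λb = cubeLamB L a M ρ i.k}) (m : ℕ),
      M₃ ≤ M → InvAt bg L mem ιCfg ops c35 a₃ M j.1 m)
    (hcurv : ∀ (M : ℝ) (j : {i : ZdIdx d L // ∃ (a : Site d) (M ρ : ℕ), L ≤ ρ ∧ ρ ≤ M ∧ 11 * d < M ∧ L ≤ d * M ∧
          i.Ω = cubeFam false L a M ρ i.k ∧ i.Λs = cubeLamS L a M ρ i.k ∧ i.Λb = cubeLamB L a M ρ i.k}) (m : ℕ),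
      M₃ ≤ M → CurvAt bg L mem ιCfg ops c35 a₃ c69 M j.1 m)
    (hlan : ∀ (M : ℝ) (j : {i : ZdIdx d L // ∃ (a : Site d) (M ρ : ℕ), L ≤ ρ ∧ ρ ≤ M ∧ 11 * d < M ∧ L ≤ d * M ∧
          i.Ω = cubeFam false L a M ρ i.k ∧ i.Λs = cubeLamS L a M ρ i.k ∧ i.Λb = cubeLamB L a M ρ i.k}) (m : ℕ),
      M₃ ≤ M → LandauAt bg L mem ιCfg ops c35 a₃ M j.1 m)
    (havg : ∀ (M : ℝ) (j : {i : ZdIdx d L // ∃ (a : Site d) (M ρ : ℕ), L ≤ ρ ∧ ρ ≤ M ∧ 11 * d < M ∧ L ≤ d * M ∧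
          i.Ω = cubeFam false L a M ρ i.k ∧ i.Λs = cubeLamS L a M ρ i.k ∧ i.Λb = cubeLamB L a M ρ i.k}) (m : ℕ),
      AvgAt L ops q M j.1 m) : False := by
  -- the sub-family is inhabited: the member of (1.131) with `a = 0`, `ρ = L`, `M = 11d + L + 1`, `k = 1`, `η = 1`
  obtain ⟨i, hk, -, hΩ, hΛs, hΛb⟩ :=
    exists_member_cube (d := d) hL (0 : Site d) (11 * d + L + 1) (le_refl L) (le_refl 1) one_pos
  have hlaw : ∃ (a : Site d) (M ρ : ℕ), L ≤ ρ ∧ ρ ≤ M ∧ 11 * d < M ∧ L ≤ d * M ∧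
      i.Ω = cubeFam false L a M ρ i.k ∧ i.Λs = cubeLamS L a M ρ i.k ∧ i.Λb = cubeLamB L a M ρ i.k := by
    refine ⟨0, 11 * d + L + 1, L, le_rfl, by omega, by omega, ?_, ?_, ?_, ?_⟩
    · calc L ≤ 11 * d + L + 1 := by omega
        _ = 1 * (11 * d + L + 1) := (one_mul _).symm
        _ ≤ d * (11 * d + L + 1) := Nat.mul_le_mul_right _ hd
    · rw [hk]; exact hΩ
    · rw [hk]; exact hΛs
    · rw [hk]; exact hΛb
  have hd0 : 0 < d := hd
  exact cube_binders_false_zero bg mem ιCfg ops hL hc₆ hK₆ ha₃ ⟨0, hd0⟩ i hL (by rw [hk]; exact hΩ) (by rw [hk]; exact hΛs)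
    (hP6 M₃ ⟨i, hlaw⟩ 0 le_rfl) (hinv M₃ ⟨i, hlaw⟩ 0 le_rfl) (hcurv M₃ ⟨i, hlaw⟩ 0 le_rfl) (hlan M₃ ⟨i, hlaw⟩ 0 le_rfl)
    (havg M₃ ⟨i, hlaw⟩ 0)

end Families


/-! ## §4 Every truncation level `m ≤ k`: the same mode, under an ℓ∞-2 margin around the non-`Λ₀` sites of `Ω₀` -/

section AllLevels

open B8Eq138LandauZd (qprimeT1)
open B7Prop3GeneralLinear (linQcov)

/-- `Q′_j(U₀)ᵀ 0 = 0` (the transpose stencil of the iterated averaging is linear; zero multipliers contribute nothing to (3.24)).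
[cite: Balaban1985BackgroundPropagators, (3.19) p.393, (3.24) p.394] -/
theorem QprimeT_zero_fun (L : ℕ) (U₀ : Site d → Fin d → 𝔸ˣ) : ∀ j : ℕ, QprimeT L U₀ j (0 : Site d → 𝔸) = 0
  | 0 => rfl
  | j + 1 => by
    have h : qprimeT1 L U₀ j (0 : Site d → 𝔸) = 0 := by
      funext x; simp [qprimeT1, conjR]
    rw [QprimeT, h, QprimeT_zero_fun L U₀ j]

/-- `LʲηQ_j(U₀)0 = 0`: the composite of the linear parts (122) at the zero field vanishes (the one-step linear part is a derivative of
`t ↦ Q(V₀, t•0)`, a constant). [cite: Balaban1985Averaging, (122) p.36, p.38 (before (133))] -/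
theorem linCovIter_zero_fun (L : ℕ) (U₀ : Site d → Fin d → 𝔸ˣ) : ∀ j : ℕ, linCovIter L U₀ (0 : Site d → Fin d → 𝔸) j = 0
  | 0 => rfl
  | j + 1 => by
    funext z κ
    rw [B7Prop4GeneralLevels.linCovIter_succ, linCovIter_zero_fun L U₀ j]
    simp [linQcov]

/-- **Locality of `Δ^η_{U₀}` (3.23)**: `(Δ^η_{U₀}f)(x)` reads `f` only at `x` and `x ± e_μ`, so it vanishes when `f` does there.
[cite: Balaban1985BackgroundPropagators, (3.23) p.394; Balaban1985RegularSpaces, (1.1) p.76] -/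
theorem covLap_eq_zero_of_vanish_near (η : ℝ) (U₀ : Site d → Fin d → 𝔸ˣ) {f : Site d → 𝔸} {x : Site d} (h0 : f x = 0)
    (h1 : ∀ μ : Fin d, f (x + e μ) = 0) (h2 : ∀ μ : Fin d, f (x - e μ) = 0) : covLap η U₀ f x = 0 := by
  unfold covLap covDivB
  refine Finset.sum_eq_zero (fun μ _ => ?_)
  simp [covDeriv, covDerivFwd, sub_add_cancel, h0, h1 μ, h2 μ, conjR]

/-- **`D^{η*}_1(dλ)(y) = 0` where `λ` is locally constant**: the flat divergence of the pure gauge `dλ` at `y` vanishes when `λ(y ± e_ν) = λ(y)`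
for all `ν`. [cite: Balaban1985RegularSpaces, (1.1) p.76, (1.38) p.82] -/
theorem covDivB_one_grad_eq_zero (η : ℝ) (lam : Site d → 𝔸) {y : Site d} (h1 : ∀ ν : Fin d, lam (y + e ν) = lam y)
    (h2 : ∀ ν : Fin d, lam (y - e ν) = lam y) :
    covDivB η (1 : Site d → Fin d → 𝔸ˣ) (fun x μ => lam (x + e μ) - lam x) y = 0 := by
  unfold covDivB
  refine Finset.sum_eq_zero (fun ν _ => ?_)
  simp [covDeriv, sub_add_cancel, h1 ν, h2 ν]

/-- The zero field satisfies the Landau condition of record at every truncation level (zero multipliers). [cite: Balaban1985RegularSpaces, (1.38) p.82, (1.42) p.83] -/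
theorem isLandau138_zero_field (L m : ℕ) (η : ℝ) (Ω₀ : Set (Site d)) (Λs : ℕ → Set (Site d)) (U₀ : Site d → Fin d → 𝔸ˣ) :
    IsLandau138 L m η Ω₀ Λs U₀ (0 : Site d → Fin d → 𝔸) := by
  refine ⟨fun _ _ => 0, fun x _ => ?_⟩
  have h0 : covDivB η U₀ (0 : Site d → Fin d → 𝔸) = 0 := by
    funext y; unfold covDivB; exact Finset.sum_eq_zero (fun ν _ => by simp [covDeriv, conjR])
  rw [h0, Set.indicator_zero', covLap_eq_zero_of_vanish_near η U₀ rfl (fun _ => rfl) (fun _ => rfl)]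
  unfold QT
  symm
  refine Finset.sum_eq_zero (fun j _ => ?_)
  have : (Λs j).indicator ((fun (_ : ℕ) (_ : Site d) => (0 : 𝔸)) j) = 0 := by
    funext y; simp
  rw [this, QprimeT_zero_fun]
  rfl

/-- **THE BOUNDARY PURE-GAUGE MODE IS IN THE LANDAU GAUGE OF RECORD AT EVERY TRUNCATION LEVEL** under the margin hypothesis «every site of
`Ω₀` that is not a level-0 restriction site has its ℓ∞-2-neighbourhood in `Ω₀`» (B8 (1.5): `Λ₀ = Ω₀ ∖ Ω₁^{(0)}` contains the boundary layer of `Ω₀`;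
the cube family: margin `R₁M₁ ≥ 2`): `D^{η*}_1 d𝟙_{Ω₀}` lives on the inner boundary layer, `Δ^η_1` of it within distance one of that layer, all inside
`Λ₀`, where the level-0 multiplier of (3.24)∕(1.42) is free; the multipliers of levels `j ≥ 1` are taken zero.
[cite: Balaban1985RegularSpaces, (1.38) p.82, (1.42) p.83, (1.5) p.77; Balaban1985BackgroundPropagators, (3.23)–(3.25) p.394] -/
theorem isLandau138_one_grad_indicator (L m : ℕ) (η : ℝ) {Ω₀ : Set (Site d)} {Λs : ℕ → Set (Site d)}
    (hdeep : ∀ x ∈ Ω₀, x ∉ Λs 0 → ∀ y : Site d, (∀ n, x n - 2 ≤ y n ∧ y n ≤ x n + 2) → y ∈ Ω₀) :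
    IsLandau138 L m η Ω₀ Λs (1 : Site d → Fin d → 𝔸ˣ)
      (fun x μ => Ω₀.indicator (fun _ => (1 : 𝔸)) (x + e μ) - Ω₀.indicator (fun _ => (1 : 𝔸)) x) := by
  classical
  set lam : Site d → 𝔸 := Ω₀.indicator (fun _ => (1 : 𝔸)) with hlam
  set f : Site d → 𝔸 := Ω₀.indicator (covDivB η (1 : Site d → Fin d → 𝔸ˣ) (fun x μ => lam (x + e μ) - lam x)) with hf
  set F : Site d → 𝔸 := fun x => covLap η (1 : Site d → Fin d → 𝔸ˣ) f x with hF
  refine ⟨fun j x => if j = 0 then F x else 0, fun x hx => ?_⟩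
  -- the right-hand side: only the level-0 multiplier survives
  have hRHS : QT L m Λs (1 : Site d → Fin d → 𝔸ˣ) (fun j x => if j = 0 then F x else 0) x = (Λs 0).indicator F x := by
    unfold QT
    rw [Finset.sum_range_succ']
    have hrest : ∑ j ∈ Finset.range m,
        QprimeT L (1 : Site d → Fin d → 𝔸ˣ) (j + 1) ((Λs (j + 1)).indicator ((fun j x => if j = 0 then F x else 0) (j + 1))) x = 0 := by
      refine Finset.sum_eq_zero (fun j _ => ?_)
      have : (Λs (j + 1)).indicator ((fun (j : ℕ) (x : Site d) => if j = 0 then F x else 0) (j + 1)) = 0 := by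
        funext y; simp
      rw [this, QprimeT_zero_fun]; rfl
    rw [hrest, zero_add]
    rfl
  rw [hRHS]
  by_cases hxΛ : x ∈ Λs 0
  · rw [Set.indicator_of_mem hxΛ]
  · -- a deep site: `f` vanishes at `x` and at its neighbours, so the left-hand side vanishes too
    rw [Set.indicator_of_notMem hxΛ]
    have hnear : ∀ y : Site d, (∀ n, x n - 1 ≤ y n ∧ y n ≤ x n + 1) → f y = 0 := by
      intro y hy
      have hyΩ : ∀ z : Site d, (∀ n, y n - 1 ≤ z n ∧ z n ≤ y n + 1) → z ∈ Ω₀ := fun z hz =>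
        hdeep x hx hxΛ z (fun n => ⟨by linarith [(hy n).1, (hz n).1], by linarith [(hy n).2, (hz n).2]⟩)
      have hy0 : y ∈ Ω₀ := hyΩ y (fun n => ⟨by linarith, by linarith⟩)
      have hlam1 : ∀ z : Site d, z ∈ Ω₀ → lam z = 1 := fun z hz => by simp [hlam, Set.indicator_of_mem hz]
      rw [hf, Set.indicator_of_mem hy0]
      refine covDivB_one_grad_eq_zero η lam (fun ν => ?_) (fun ν => ?_)
      · rw [hlam1 y hy0, hlam1 (y + e ν) (hyΩ _ (fun n => ?_))]
        simp only [Pi.add_apply, B7Prop1Explicit.e_apply]; split_ifs <;> omega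
      · rw [hlam1 y hy0, hlam1 (y - e ν) (hyΩ _ (fun n => ?_))]
        simp only [Pi.sub_apply, B7Prop1Explicit.e_apply]; split_ifs <;> omega
    exact covLap_eq_zero_of_vanish_near η 1 (hnear x (fun n => ⟨by linarith, by linarith⟩))
      (fun μ => hnear _ (fun n => by simp only [Pi.add_apply, B7Prop1Explicit.e_apply]; split_ifs <;> omega))
      (fun μ => hnear _ (fun n => by simp only [Pi.sub_apply, B7Prop1Explicit.e_apply]; split_ifs <;> omega))

/-- **`|B₁| = 0` AT EVERY TRUNCATION LEVEL `m ≤ k` FOR A FIELD VANISHING ON THE BONDS WITH BOTH END-POINTS IN `Ω₀`**: by the member law `hbox`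
the locality box `Bʲ(c₋) ∪ Bʲ(c₊)` of every constraint bond lies in `Ω_j ⊂ Ω₀`, and `LʲηQ_j(U₀)B(c)` depends on `B` only through the bonds of that
box (`B9Ineq3137LocalSup.linCovIter_congr`, p. 24 «this definition is local»), where `B = 0`. [cite: Balaban1985RegularSpaces, (1.56) p.86, (1.31) p.82; Balaban1985Averaging, p.24 (after (43)), p.38 (before (133))] -/
theorem wsupB1_eq_zero_of_vanish_inside {L : ℕ} (hL : 1 ≤ L) (i : ZdIdx d L) {m : ℕ} (hm : m ≤ i.k) (U₀ : Site d → Fin d → 𝔸ˣ)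
    {B : Site d → Fin d → 𝔸} (hB : ∀ (z : Site d) (κ : Fin d), z ∈ i.Ω 0 → z + e κ ∈ i.Ω 0 → B z κ = 0) :
    wsup 1 (fun p : {p : ℕ × (Site d × Fin d) // p.1 ≤ m ∧ p.2 ∈ i.Λb m p.1} =>
      linCovIter L U₀ B p.1.1 p.1.2.1 p.1.2.2) = 0 := by
  apply le_antisymm
  · refine B8Eq155JBound.wsup_le (fun p => ?_) le_rfl
    obtain ⟨⟨j, z, κ⟩, hj, hc⟩ := p
    have hbox : ∀ x, InBox (loK L j z) (bondHiK L j z κ) x → x ∈ i.Ω 0 := fun x hx =>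
      B9SupplySockB9P3ZdLettersOmega.omega_subset_of_le i (Nat.zero_le j) (i.hbox m hm j hj (z, κ) hc x hx)
    have hagree : B7Prop1Local.AgreeOn (loK L j z) (bondHiK L j z κ) B 0 := fun x κ' hx hxe =>
      hB x κ' (hbox x hx) (hbox _ hxe)
    have h := B9Ineq3137LocalSup.linCovIter_congr L hL j (U₀ := U₀) (U₀' := U₀) z κ (fun _ _ _ _ => rfl) hagree
    dsimp only
    rw [h, linCovIter_zero_fun]
    simp
  · exact Real.iSup_nonneg (fun p => mul_nonneg zero_le_one (norm_nonneg _))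

/-- The weight `(Lʲη)^{1}` of `|·|₍₋₁₎` is non-decreasing in the level `j` (`L ≥ 1`). [cite: Balaban1985RegularSpaces, p.86 (definition after (1.55))] -/
theorem weight_negOne_mono {L : ℕ} (hL : 1 ≤ L) {η : ℝ} (hη : 0 ≤ η) {j m : ℕ} (hjm : j ≤ m) :
    weight L η (-(1 : ℝ)) j ≤ weight L η (-(1 : ℝ)) m := by
  unfold weight
  simp only [neg_neg, Real.rpow_one]
  exact mul_le_mul_of_nonneg_right (pow_le_pow_right₀ (by exact_mod_cast hL) hjm) hη

variable [Nontrivial 𝔸]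
variable {I : Type} (bg : I → B9.Backgrounds) {L : ℕ} (mem : ℝ → ZdIdx d L → ℕ → I)
variable (ιCfg : ∀ (M : ℝ) (i : ZdIdx d L) (m : ℕ) (U₀ : Site d → Fin d → 𝔸ˣ),
  (∀ x κ, U₀ x κ ∈ unitaryUnits 𝔸) → (bg (mem M i m)).Cfg)
variable (ops : ℝ → ZdIdx d L → ℕ → OpsZd d 𝔸)

/-- ★★ **THE BOUNDARY PURE-GAUGE MODE REFUTES THE JOINT SATISFIABILITY OF THE MEMBER-LOCAL LETTER BINDERS AT EVERY TRUNCATION LEVEL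
`m ≤ k`.**  As `at_binders_false_zero`, at `(M, i, m)`, with (h1) replaced by the margin hypothesis «every `x ∈ Ω₀ ∖ Λs m 0` has its
ℓ∞-2-neighbourhood in `Ω₀`» (then `g = d(𝟙_{Ω₀}·1)` is in the Landau gauge of record, `isLandau138_one_grad_indicator`, and `|B₁(g)| = 0` at all
levels, `wsupB1_eq_zero_of_vanish_inside`): the five binders give `Δ_a(1)g = 0 = Δ_a(1)0` on the bonds of `Ω₀`, so (3.27) returns `G(1)0 = g`
and `G(1)0 = 0`, contradicting `g(x₀, μ₀) = −1`.  Restricting the truncation levels is therefore NOT a repair.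
[cite: Balaban1985BackgroundPropagators, (3.26)–(3.27) p.395, (3.4) p.391, (3.69) p.404, (3.16) p.393, (3.20)–(3.25) p.394; Balaban1985RegularSpaces, p.77 (bond convention), (1.5) p.77, (1.58) p.86, (1.68) p.88] -/
theorem at_binders_false (hL : 1 ≤ L) {c35 c₆ K₆ a₃ c69 q M : ℝ} (hc₆ : 0 < c₆) (hK₆ : 0 < K₆) (ha₃ : 0 < a₃)
    (i : ZdIdx d L) {m : ℕ} (hm : m ≤ i.k)
    (hdeep : ∀ x ∈ i.Ω 0, x ∉ i.Λs m 0 → ∀ y : Site d, (∀ n, x n - 2 ≤ y n ∧ y n ≤ x n + 2) → y ∈ i.Ω 0)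
    {x₀ : Site d} {μ₀ : Fin d} (hx₀ : x₀ ∈ i.Ω 0) (hx₁ : x₀ + e μ₀ ∉ i.Ω 0)
    (hP6 : Prop6At bg L mem ιCfg c35 c₆ K₆ M i m) (hinv : InvAt bg L mem ιCfg ops c35 a₃ M i m)
    (hcurv : CurvAt bg L mem ιCfg ops c35 a₃ c69 M i m) (hlan : LandauAt bg L mem ιCfg ops c35 a₃ M i m)
    (havg : AvgAt L ops q M i m) : False := by
  classical
  have hη : 0 < i.η := i.hη
  have h1u : ∀ x κ, (1 : Site d → Fin d → 𝔸ˣ) x κ ∈ unitaryUnits 𝔸 := fun _ _ => (unitaryUnits 𝔸).one_mem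
  obtain ⟨ε, hε, hεP⟩ := exists_small_window hc₆ hK₆ ha₃ M
  have hReg : ∀ α : ℝ, 0 < α → α ≤ ε → (bg (mem M i m)).Reg335 c35 (K₆ * α) (ιCfg M i m 1 h1u) :=
    fun α hα hαε => hP6 α 1 h1u hα (hεP α hα hαε).1 (B8Prop6OfThm4.one_inAk hL m hη hα i.Ω)
  -- the boundary pure-gauge mode and the zero field, both in E(Ω₀) at truncation `m`
  set lam : Site d → 𝔸 := (i.Ω 0).indicator (fun _ => (1 : 𝔸)) with hlam
  set g : Site d → Fin d → 𝔸 := fun x μ => lam (x + e μ) - lam x with hg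
  have hg_in : ∀ (y : Site d) (τ : Fin d), y ∈ i.Ω 0 → y + e τ ∈ i.Ω 0 → g y τ = 0 := by
    intro y τ h1 h2
    simp [hg, hlam, Set.indicator_of_mem h1, Set.indicator_of_mem h2]
  have hgOn : OnDom L m i.η i.Ω g := by
    refine ⟨fun y τ h => ?_, weight L i.η (-(1 : ℝ)) m * (‖(1 : 𝔸)‖ + ‖(1 : 𝔸)‖), fun j hj b _ => ?_⟩
    · simp only [BondTouches, not_or] at h
      simp [hg, hlam, Set.indicator_of_notMem h.1, Set.indicator_of_notMem h.2]
    · refine mul_le_mul (weight_negOne_mono hL hη.le hj) ?_ (norm_nonneg _) (B8ScaledSupNorm.weight_nonneg L hη.le _ _)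
      calc ‖g b.1 b.2‖ ≤ ‖lam (b.1 + e b.2)‖ + ‖lam b.1‖ := norm_sub_le _ _
        _ ≤ ‖(1 : 𝔸)‖ + ‖(1 : 𝔸)‖ :=
          add_le_add (norm_indicator_le_norm_self _ _) (norm_indicator_le_norm_self _ _)
  have h0On : OnDom L m i.η i.Ω (0 : Site d → Fin d → 𝔸) :=
    ⟨fun _ _ _ => rfl, 0, fun j _ b _ => by simp⟩
  -- (a) the averaging letter vanishes at the bonds of `Ω₀` on the fields of E(Ω₀) vanishing on the bonds inside `Ω₀`
  have hQQ : ∀ A : Site d → Fin d → 𝔸, OnDom L m i.η i.Ω A →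
      (∀ (z : Site d) (κ : Fin d), z ∈ i.Ω 0 → z + e κ ∈ i.Ω 0 → A z κ = 0) →
      ∀ (y : Site d) (τ : Fin d), BondTouches (i.Ω 0) y τ → (ops M i m).QQ 1 A y τ = 0 := by
    intro A hA hAin y τ hb
    have h := havg 1 h1u A hA 0 (Nat.zero_le m) y τ hb
    have hw := wsupB1_eq_zero_of_vanish_inside hL i hm (1 : Site d → Fin d → 𝔸ˣ) (B := iEta i.η A)
      (fun z κ h1 h2 => by simp [iEta, hAin z κ h1 h2])
    rw [hw, mul_zero, pow_zero, one_mul] at h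
    exact norm_le_zero_iff.mp (le_of_mul_le_mul_left (by rw [mul_zero]; exact h) (pow_pos hη 3))
  -- (b) the Landau letter vanishes on `g` (the mode is in the Landau gauge of record) and on `0`
  have hR := hReg ε hε le_rfl
  have hDRDs_g : ∀ (y : Site d) (τ : Fin d), (ops M i m).DRDs 1 g y τ = 0 := fun y τ =>
    hlan (K₆ * ε) 1 h1u (by positivity) (hεP ε hε le_rfl).2 hR g hgOn
      (isLandau138_one_grad_indicator L m i.η hdeep) y τ
  have hDRDs_0 : ∀ (y : Site d) (τ : Fin d), (ops M i m).DRDs 1 0 y τ = 0 := fun y τ =>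
    hlan (K₆ * ε) 1 h1u (by positivity) (hεP ε hε le_rfl).2 hR 0 h0On
      (isLandau138_zero_field L m i.η (i.Ω 0) (i.Λs m) 1) y τ
  -- (c) the curvature letter vanishes at the bonds of `Ω₀` on E(Ω₀) at `U₀ = 1`
  have hDp : ∀ A : Site d → Fin d → 𝔸, OnDom L m i.η i.Ω A →
      ∀ (y : Site d) (τ : Fin d), BondTouches (i.Ω 0) y τ → (ops M i m).Dp 1 A y τ = 0 := by
    intro A hA y τ hb
    have hT : i.η ^ 3 * ‖(ops M i m).Dp 1 A y τ‖ ≤ 0 := by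
      refine nonpos_of_le_mul_small (C := c69 * M * K₆ *
        msup L m i.η (-(1 : ℝ)) (fun j (b : Site d × Fin d) => SideTouches (i.Ω j) b.1 b.2) (fun b => A b.1 b.2)) hε
        (fun α hα hαε => ?_)
      have h := hcurv (K₆ * α) 1 h1u (by positivity) (hεP α hα hαε).2 (hReg α hα hαε) A hA 0 (Nat.zero_le m) y τ hb
      rw [pow_zero, one_mul] at h
      linarith
    exact norm_le_zero_iff.mp (le_of_mul_le_mul_left (by rw [mul_zero]; exact hT) (pow_pos hη 3))
  -- (d) `Δ_a(1)g = 0 = Δ_a(1)0` on the bonds of `Ω₀`; (3.27) returns both `g` and `0` from `J = 0`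
  have hJg : ∀ (y : Site d) (τ : Fin d), BondTouches (i.Ω 0) y τ →
      (0 : Site d → Fin d → 𝔸) y τ = deltaAOf i.η (ops M i m) 1 g y τ := by
    intro y τ hb
    rw [deltaAOf, hDp g hgOn y τ hb, hDRDs_g y τ, hQQ g hgOn hg_in y τ hb, hg, Jcur_one_grad]
    simp
  have hJ0 : ∀ (y : Site d) (τ : Fin d), BondTouches (i.Ω 0) y τ →
      (0 : Site d → Fin d → 𝔸) y τ = deltaAOf i.η (ops M i m) 1 0 y τ := by
    intro y τ hb
    rw [deltaAOf, hDp 0 h0On y τ hb, hDRDs_0 y τ, hQQ 0 h0On (fun _ _ _ _ => rfl) y τ hb,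
      B9SupplySockB9P3ZdLettersOmega.Jcur_zero]
    simp
  have hGg : (ops M i m).Gop 1 0 = g :=
    hinv (K₆ * ε) 1 h1u (by positivity) (hεP ε hε le_rfl).2 hR g hgOn 0 hJg
  have hG0 : (ops M i m).Gop 1 0 = 0 :=
    hinv (K₆ * ε) 1 h1u (by positivity) (hεP ε hε le_rfl).2 hR 0 h0On 0 hJ0
  have hg0 : g x₀ μ₀ = 0 := by rw [← hGg, hG0]; rfl
  have hg1 : g x₀ μ₀ = -1 := by
    simp [hg, hlam, Set.indicator_of_mem hx₀, Set.indicator_of_notMem hx₁]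
  rw [hg1] at hg0
  exact one_ne_zero (neg_eq_zero.mp hg0)

open B8Eq131CubesAdmissible (cubeFam cubeFam_false_zero cubeFam_false_of_le)
open B8Eq131Cubes (cube sqLo sqHi)
open B8CubeMemberZd (cubeLamS cubeLamB cubeLamS_self cubeLamS_of_lt mem_cubeLam_zero_iff)
open B9SupplySockB9P3ZdLettersOmega (margin2_cubeFam)

/-- **The margin hypothesis at the cube member of (1.131)** (`R₁M₁ = ρ ≥ 2`): a site of `□₀` outside `Λs m 0` (for `m ≥ 1`: outside `Λ₀ = □₀ ∖ □₁`, i.e.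
in `□₁`; for `m = 0` there is none) has its ℓ∞-2-neighbourhood in `□₀` (`B9SupplySockB9P3ZdLettersOmega.margin2_cubeFam`). [cite: Balaban1985RegularSpaces, p.98 («a distance between boundaries of these cubes is equal to R₁M₁Lʲη»), (1.131) p.99, (1.5) p.77] -/
theorem cube_deep {i : ZdIdx d L} (hL : 1 ≤ L) {a : Site d} {M ρ : ℕ} (hρ : 2 ≤ ρ)
    (hΩ : i.Ω = cubeFam false L a M ρ i.k) (hΛs : i.Λs = cubeLamS L a M ρ i.k) (m : ℕ) :
    ∀ x ∈ i.Ω 0, x ∉ i.Λs m 0 → ∀ y : Site d, (∀ n, x n - 2 ≤ y n ∧ y n ≤ x n + 2) → y ∈ i.Ω 0 := by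
  intro x hx hxΛ y hy
  rcases Nat.eq_zero_or_pos m with rfl | hm
  · exact absurd (cube_zero_subset_lamS hΩ hΛs hx) hxΛ
  · -- `Λs m 0 = Λ₀ = □₀ ∖ □₁`, so `x ∈ □₁`, whose ℓ∞-2-neighbourhood lies in `□₀` (margin `R₁M₁ ≥ 2`)
    rw [hΛs, cubeLamS_of_lt L a M ρ i.k hm, mem_cubeLam_zero_iff hL a M ρ i.hk] at hxΛ
    rw [hΩ, cubeFam_false_zero] at hx
    have hx1 : x ∈ cube L a M ρ i.k 1 := by
      by_contra h; exact hxΛ ⟨hx, h⟩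
    have hM2 := margin2_cubeFam L a M hρ i.k
    rw [hΩ]
    exact hM2 1 le_rfl x (by rw [cubeFam_false_of_le L a M ρ i.hk]; exact hx1) y hy

/-- ★★ **AT EVERY CUBE MEMBER `{□_j}` OF (1.131) (`Ω = cubeFam false L a M ρ k`, `Λs = cubeLamS …`, `ρ ≥ 2`) AND EVERY TRUNCATION LEVEL `m ≤ k`
THE FIVE BINDERS `Prop6At`, `InvAt`, `CurvAt`, `LandauAt`, `AvgAt` AT `(M, i, m)` ARE JOINTLY UNSATISFIABLE** (any frame, any letters, any `M`,
`0 < c₆, K₆, a₃`). [cite: Balaban1985RegularSpaces, (1.131) p.99, (1.68) p.88, p.77 (bond convention); Balaban1985BackgroundPropagators, (3.27) p.395] -/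
theorem cube_binders_false (hL : 1 ≤ L) {c35 c₆ K₆ a₃ c69 q M : ℝ} (hc₆ : 0 < c₆) (hK₆ : 0 < K₆) (ha₃ : 0 < a₃)
    (μ : Fin d) (i : ZdIdx d L) {a : Site d} {Mc ρ : ℕ} (hρ : 2 ≤ ρ)
    (hΩ : i.Ω = cubeFam false L a Mc ρ i.k) (hΛs : i.Λs = cubeLamS L a Mc ρ i.k) {m : ℕ} (hm : m ≤ i.k)
    (hP6 : Prop6At bg L mem ιCfg c35 c₆ K₆ M i m) (hinv : InvAt bg L mem ιCfg ops c35 a₃ M i m)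
    (hcurv : CurvAt bg L mem ιCfg ops c35 a₃ c69 M i m) (hlan : LandauAt bg L mem ιCfg ops c35 a₃ M i m)
    (havg : AvgAt L ops q M i m) : False :=
  at_binders_false bg mem ιCfg ops hL hc₆ hK₆ ha₃ i hm (cube_deep hL hρ hΩ hΛs m)
    (cube_corner_boundary_bond (le_trans one_le_two hρ) hΩ μ).1 (cube_corner_boundary_bond (le_trans one_le_two hρ) hΩ μ).2
    hP6 hinv hcurv hlan havg

end AllLevels

end Literature.MathematicalPhysics.QuantumFieldTheory.Balaban1983to89.B9SupplySockB9P3ZdAtBoundaryMode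

end
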